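import Summits.CriticalPhenomena.SAWScalingLimit.Theses.SAWPoincareChain
import Summits.CriticalPhenomena.SAWScalingLimit.Theorems.SAWWeldingIdentificationLimitUpgrade

/-!
# Line `birth` — checked BC3 skeleton for the crux `LatticeJoinsChain`
# (stmt-CriticalPhenomena-7558, route `SAWPoincareChain`, rank 5, sub-problem `SAWScalingLimit`)

Crux (fixed, concluded BY NAME): `SAWPoincareChain.LatticeJoinsChain` — for every `Q` with the
`ChainLaw` property (eventually chordal, exactly conformally covariant, disc law = weak limit of the
inlined Poincaré-chain approximants), every Dobrushin domain `(D; a, b)` and every `ℤ²` endpoint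
approximation there is a step schedule `e(δ) → 0⁺` along which the critical `δℤ²` SAW law (pushed to
`CurveClass ℂ`) and the chain law `Q (e δ) D` are asymptotically equal on bounded continuous test
functions.

THE LINE (the route's own TWO-LAYER PLAN for `Z`, "LatticeJoinsChain ⇐ Z2EventualTight →
Z2SimpleLimits → AvoidanceUniversality", typed at the level where the tree already PROVES the glue):
the classical Prokhorov/Billingsley architecture of every lattice-to-SLE proof (Duminil-Copin–Smirnov
2012, proof of Thm. 3.13: tightness + identification of subsequential limits + uniqueness), with the
identification target replaced by THE CHAIN'S OWN LIMIT instead of SLE — so that nothing on the chain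
side (restriction, LSW) is re-assumed here:

* `stub_latticeTight` (Z2EventualTight; OPEN, size XL; verbatim the `IsTightAlongMesh` form of the
  shared item `SAWParafermion.EventualTight`, stmt-CriticalPhenomena-1881): under an endpoint
  approximation the critical `δℤ²` SAW curve laws are tight as `δ → 0⁺`.
* `stub_chainLimit` (chain side; size L GIVEN the route's other cruxes — it is exactly what
  `ObstacleIsMetric` + `SubCurvatureTightness` + the PROVED supports `DiscRestrictionIsSLE`,
  `DiscToDomains` deliver via `Theorems.exists_isSLELaw_tendstoLaw_unitDisc`, minus the SLE
  identification, which this line does not need): for every `Q` with the ChainLaw property and every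
  Dobrushin domain `D`, the chain laws `Q t D` converge weakly as `t → 0⁺` to a probability law `ν_D`.
* `stub_limitsJoin` (AvoidanceUniversality ∘ Z2SimpleLimits, the ℤ²-specific universality content;
  OPEN, hardest): every probability subsequential weak limit `μ` of the critical `δℤ²` SAW curve laws
  of `(D; a_δ, b_δ)` equals the chain's limit `ν_D` (whenever `Q t D ⇒ ν_D`). Foreseen refinement
  (NOT filed, no third layer): `μ` is carried by simple chords (Z2SimpleLimits) and its hull-avoidance
  probabilities equal those of `ν_D` (AvoidanceUniversality); laws on simple chords are determined by
  hull-avoidance probabilities (`CurveClass.Measure.ext_of_missCode_injOn`).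
* `LatticeJoinsChain_of : Stubs.stub_latticeTight → Stubs.stub_chainLimit → Stubs.stub_limitsJoin →
  LatticeJoinsChain` — PROVED (no `sorry`): take `ν_D` from `stub_chainLimit`; the SAW laws are
  probability measures for all small `δ` (`SubseqIdentification.Negative.eventually_isProbabilityMeasure_law`)
  and the curve observable is measurable (`SAW.aemeasurable_curve`), so the tree's Prokhorov +
  subsequence-principle upgrade for eventually-probability laws
  (`Theorems.tendstoLaw_of_isTightAlongMesh_of_eventually`, Billingsley Thm. 5.1 Corollary) turns
  `stub_latticeTight` + `stub_limitsJoin` into `SAW.law ⇒ ν_D` along `𝓝[>] 0`; with `Q t D ⇒ ν_D`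
  the schedule `e = id` works (difference of two limits with the same value).

Why the stubs are not the crux / the summit in disguise: `stub_latticeTight` is tightness only (no
identification); `stub_chainLimit` speaks of the chain alone (no lattice); `stub_limitsJoin` is
conditional on a chain limit AND on a lattice subsequential limit existing, and says nothing about
SLE — none implies `LatticeJoinsChain` or `SAWScalingLimit` without the others (BC3 probes in
`bc/probe_*.lean`, all FAIL as required).

Disproof used: none relevant (no `Cruxes/LatticeJoinsChain/Disproof.lean` exists at registration;
`ledger negatives`: the only SAW-tightness negative is the ALL-`δ ∈ (0,1]` form `IsTightLaws`
refuted as stmt-CriticalPhenomena-0772 — `stub_latticeTight` is the EVENTUAL `IsTightAlongMesh`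
form, which that witness does not touch).
-/

noncomputable section

open MeasureTheory Filter Topology Set
open scoped NNReal ENNReal BoundedContinuousFunction
open Literature.Probability.RandomPlanarGeometry Literature.Probability.LatticeModels
open Summit.CriticalPhenomena.SAWScalingLimit.Theses.SAWPoincareChain
open Summit.CriticalPhenomena.SAWScalingLimit.Theorems

namespace Summit.CriticalPhenomena.SAWScalingLimit.Cruxes.LatticeJoinsChain.Birth

/-! ## The three registered stubs: precise `Prop`s `Stubs.stub_*` (hypotheses of `LatticeJoinsChain_of`
BY NAME) + the sorried theorems `stub_*` with the same statements spelled out over tree declarations -/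

namespace Stubs

/-- **Stub `Prop` 1 (`latticeTight`, Z2EventualTight)** — tightness along the mesh of the critical
`δℤ²` SAW curve laws under an endpoint approximation (verbatim `SAWParafermion.EventualTight`). -/
def stub_latticeTight : Prop :=
  ∀ (D : Literature.Probability.RandomPlanarGeometry.DobrushinDomain) (a b : ℝ → Literature.Probability.LatticeModels.Site 2), Literature.Probability.RandomPlanarGeometry.SAW.IsEndpointApprox D a b → Literature.Probability.RandomPlanarGeometry.IsTightAlongMesh (fun δ (γ : Literature.Probability.RandomPlanarGeometry.SAW.DomainSAW D.carrier δ (a δ) (b δ)) => γ.curve) (fun δ => Literature.Probability.RandomPlanarGeometry.SAW.law D.carrier δ (a δ) (b δ))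

/-- **Stub `Prop` 2 (`chainLimit`)** — for every `Q` with the ChainLaw property and every Dobrushin
domain `D`, the chain laws `Q t D` converge weakly as `t → 0⁺` to a probability law. -/
def stub_chainLimit : Prop :=
  ∀ Q : ℝ → Literature.Probability.RandomPlanarGeometry.ChordalFamily, (∀ᶠ t in nhdsWithin (0:ℝ) (Set.Ioi 0), (Q t).IsChordal ∧ (Q t).IsConformallyCovariant ∧ Literature.Probability.RandomPlanarGeometry.TendstoLaw (fun (_ : ℝ) (x : Literature.Probability.RandomPlanarGeometry.CurveClass ℂ) => x) (fun r => (fun S : MeasureTheory.Measure (Literature.Probability.RandomPlanarGeometry.CurveClass ℂ) => (S Set.univ)⁻¹ • S) ((fun (xc t ρ : ℝ) (pos : (ℕ → ℝ) → ℕ → ℂ) => MeasureTheory.Measure.sum fun n : ℕ => ENNReal.ofReal ((xc / (2 * Real.pi)) ^ n) • ((MeasureTheory.volume.restrict {θ : Fin n → ℝ | (∀ k, θ k ∈ Set.Ico (0:ℝ) (2 * Real.pi)) ∧ (∀ i j : ℕ, i + 2 ≤ j → j ≤ n → t * ‖1 - (starRingEnd ℂ) (pos (fun k => if h : k < n then θ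 ⟨k, h⟩ else 0) i) * pos (fun k => if h : k < n then θ ⟨k, h⟩ else 0) j‖ < ‖pos (fun k => if h : k < n then θ ⟨k, h⟩ else 0) i - pos (fun k => if h : k < n then θ ⟨k, h⟩ else 0) j‖) ∧ 2 * ‖pos (fun k => if h : k < n then θ ⟨k, h⟩ else 0) n + ↑ρ‖ ≤ ‖1 + ↑ρ * pos (fun k => if h : k < n then θ ⟨k, h⟩ else 0) n‖}).map (fun θ => Literature.Probability.RandomPlanarGeometry.CurveClass.mk (⟨Literature.Probability.LatticeModels.polyline ((List.range (n + 1)).map (pos (fun k => if h : k < n then θ ⟨k, h⟩ else 0)))⟩ : Literature.Probability.RandomPlanarGeometry.Curve ℂ)))) ((⨅ n : ℕ, ((MeasureTheory.volume {θ : Fin (n + 1) → ℝ | (∀ k, θ k ∈ Set.Ico (0:ℝ) (2 * Real.pi)) ∧ ∀ i j : ℕ, i + 2 ≤ j → j ≤ n + 1 → 1 < ‖(List.range i).foldl (fun (z : ℂ) (m : ℕ) => z + Complex.exp (↑(if h : m < n + 1 then θ ⟨m, h⟩ else 0) * Complex.I)) 0 - (List.range j).foldl (fun (z : ℂ) (m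 : ℕ) => z + Complex.exp (↑(if h : m < n + 1 then θ ⟨m, h⟩ else 0) * Complex.I)) 0‖}).toReal / (2 * Real.pi) ^ (n + 1)) ^ (1 / ((n : ℝ) + 1)))⁻¹) t (1 - r) (fun θ k => (List.range k).foldl (fun (z : ℂ) (j : ℕ) => (z + ↑t * Complex.exp (↑(θ j) * Complex.I)) / (1 + (starRingEnd ℂ) z * (↑t * Complex.exp (↑(θ j) * Complex.I)))) (↑(1 - r) : ℂ)))) id (Q t Literature.Probability.RandomPlanarGeometry.DobrushinDomain.unitDisc)) → ∀ D : Literature.Probability.RandomPlanarGeometry.DobrushinDomain, ∃ ν : MeasureTheory.Measure (Literature.Probability.RandomPlanarGeometry.CurveClass ℂ), MeasureTheory.IsProbabilityMeasure ν ∧ Literature.Probability.RandomPlanarGeometry.TendstoLaw (fun (_ : ℝ) (x : Literature.Probability.RandomPlanarGeometry.CurveClass ℂ) => x) (fun t => Q t D) id ν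

/-- **Stub `Prop` 3 (`limitsJoin`, the universality step; hardest)** — every probability
subsequential weak limit of the critical `δℤ²` SAW curve laws of `(D; a_δ, b_δ)` equals the chain's
weak limit `ν` in `D`. -/
def stub_limitsJoin : Prop :=
  ∀ Q : ℝ → Literature.Probability.RandomPlanarGeometry.ChordalFamily, (∀ᶠ t in nhdsWithin (0:ℝ) (Set.Ioi 0), (Q t).IsChordal ∧ (Q t).IsConformallyCovariant ∧ Literature.Probability.RandomPlanarGeometry.TendstoLaw (fun (_ : ℝ) (x : Literature.Probability.RandomPlanarGeometry.CurveClass ℂ) => x) (fun r => (fun S : MeasureTheory.Measure (Literature.Probability.RandomPlanarGeometry.CurveClass ℂ) => (S Set.univ)⁻¹ • S) ((fun (xc t ρ : ℝ) (pos : (ℕ → ℝ) → ℕ → ℂ) => MeasureTheory.Measure.sum fun n : ℕ => ENNReal.ofReal ((xc / (2 * Real.pi)) ^ n) • ((MeasureTheory.volume.restrict {θ : Fin n → ℝ | (∀ k, θ k ∈ Set.Ico (0:ℝ) (2 * Real.pi)) ∧ (∀ i j : ℕ, i + 2 ≤ j → j ≤ n → t * ‖1 - (starRingEnd ℂ) (pos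 (fun k => if h : k < n then θ ⟨k, h⟩ else 0) i) * pos (fun k => if h : k < n then θ ⟨k, h⟩ else 0) j‖ < ‖pos (fun k => if h : k < n then θ ⟨k, h⟩ else 0) i - pos (fun k => if h : k < n then θ ⟨k, h⟩ else 0) j‖) ∧ 2 * ‖pos (fun k => if h : k < n then θ ⟨k, h⟩ else 0) n + ↑ρ‖ ≤ ‖1 + ↑ρ * pos (fun k => if h : k < n then θ ⟨k, h⟩ else 0) n‖}).map (fun θ => Literature.Probability.RandomPlanarGeometry.CurveClass.mk (⟨Literature.Probability.LatticeModels.polyline ((List.range (n + 1)).map (pos (fun k => if h : k < n then θ ⟨k, h⟩ else 0)))⟩ : Literature.Probability.RandomPlanarGeometry.Curve ℂ)))) ((⨅ n : ℕ, ((MeasureTheory.volume {θ : Fin (n + 1) → ℝ | (∀ k, θ k ∈ Set.Ico (0:ℝ) (2 * Real.pi)) ∧ ∀ i j : ℕ, i + 2 ≤ j → j ≤ n + 1 → 1 < ‖(List.range i).foldl (fun (z : ℂ) (m : ℕ) => z + Complex.exp (↑(if h : m < n + 1 then θ ⟨m, h⟩ else 0) * Complex.I)) 0 - (List.range j).foldl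 (fun (z : ℂ) (m : ℕ) => z + Complex.exp (↑(if h : m < n + 1 then θ ⟨m, h⟩ else 0) * Complex.I)) 0‖}).toReal / (2 * Real.pi) ^ (n + 1)) ^ (1 / ((n : ℝ) + 1)))⁻¹) t (1 - r) (fun θ k => (List.range k).foldl (fun (z : ℂ) (j : ℕ) => (z + ↑t * Complex.exp (↑(θ j) * Complex.I)) / (1 + (starRingEnd ℂ) z * (↑t * Complex.exp (↑(θ j) * Complex.I)))) (↑(1 - r) : ℂ)))) id (Q t Literature.Probability.RandomPlanarGeometry.DobrushinDomain.unitDisc)) → ∀ (D : Literature.Probability.RandomPlanarGeometry.DobrushinDomain) (a b : ℝ → Literature.Probability.LatticeModels.Site 2), Literature.Probability.RandomPlanarGeometry.SAW.IsEndpointApprox D a b → ∀ ν : MeasureTheory.Measure (Literature.Probability.RandomPlanarGeometry.CurveClass ℂ), MeasureTheory.IsProbabilityMeasure ν → Literature.Probability.RandomPlanarGeometry.TendstoLaw (fun (_ : ℝ) (x : Literature.Probability.RandomPlanarGeometry.CurveClass ℂ) => x) (fun t => Q t D) id ν → ∀ μ : MeasureTheory.Measure (Literature.Probability.RandomPlanarGeometry.CurveClass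 ℂ), MeasureTheory.IsProbabilityMeasure μ → Literature.Probability.RandomPlanarGeometry.IsSubseqLimitLaw (fun δ (γ : Literature.Probability.RandomPlanarGeometry.SAW.DomainSAW D.carrier δ (a δ) (b δ)) => γ.curve) (fun δ => Literature.Probability.RandomPlanarGeometry.SAW.law D.carrier δ (a δ) (b δ)) μ → μ = ν

end Stubs

/-- **Stub 1 (`latticeTight`, Z2EventualTight; OPEN).** [cite: AizenmanBurchard1999, Thm 1.1]
[cite: DuminilCopinSmirnov2012, Thm 3.13 (proof)] -/
theorem stub_latticeTight : ∀ (D : Literature.Probability.RandomPlanarGeometry.DobrushinDomain) (a b : ℝ → Literature.Probability.LatticeModels.Site 2), Literature.Probability.RandomPlanarGeometry.SAW.IsEndpointApprox D a b → Literature.Probability.RandomPlanarGeometry.IsTightAlongMesh (fun δ (γ : Literature.Probability.RandomPlanarGeometry.SAW.DomainSAW D.carrier δ (a δ) (b δ)) => γ.curve) (fun δ => Literature.Probability.RandomPlanarGeometry.SAW.law D.carrier δ (a δ) (b δ)) := by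
  sorry

/-- **Stub 2 (`chainLimit`; the chain's own scaling limit in every domain).**
[cite: BillingsleyCPM1999, Thm. 5.1, Corollary] [cite: LawlerSchrammWerner2003Restriction, Thm 6.1] -/
theorem stub_chainLimit : ∀ Q : ℝ → Literature.Probability.RandomPlanarGeometry.ChordalFamily, (∀ᶠ t in nhdsWithin (0:ℝ) (Set.Ioi 0), (Q t).IsChordal ∧ (Q t).IsConformallyCovariant ∧ Literature.Probability.RandomPlanarGeometry.TendstoLaw (fun (_ : ℝ) (x : Literature.Probability.RandomPlanarGeometry.CurveClass ℂ) => x) (fun r => (fun S : MeasureTheory.Measure (Literature.Probability.RandomPlanarGeometry.CurveClass ℂ) => (S Set.univ)⁻¹ • S) ((fun (xc t ρ : ℝ) (pos : (ℕ → ℝ) → ℕ → ℂ) => MeasureTheory.Measure.sum fun n : ℕ => ENNReal.ofReal ((xc / (2 * Real.pi)) ^ n) • ((MeasureTheory.volume.restrict {θ : Fin n → ℝ | (∀ k, θ k ∈ Set.Ico (0:ℝ) (2 * Real.pi)) ∧ (∀ i j : ℕ, i + 2 ≤ j → j ≤ n → t * ‖1 - (starRingEnd ℂ) (pos (fun k =>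 if h : k < n then θ ⟨k, h⟩ else 0) i) * pos (fun k => if h : k < n then θ ⟨k, h⟩ else 0) j‖ < ‖pos (fun k => if h : k < n then θ ⟨k, h⟩ else 0) i - pos (fun k => if h : k < n then θ ⟨k, h⟩ else 0) j‖) ∧ 2 * ‖pos (fun k => if h : k < n then θ ⟨k, h⟩ else 0) n + ↑ρ‖ ≤ ‖1 + ↑ρ * pos (fun k => if h : k < n then θ ⟨k, h⟩ else 0) n‖}).map (fun θ => Literature.Probability.RandomPlanarGeometry.CurveClass.mk (⟨Literature.Probability.LatticeModels.polyline ((List.range (n + 1)).map (pos (fun k => if h : k < n then θ ⟨k, h⟩ else 0)))⟩ : Literature.Probability.RandomPlanarGeometry.Curve ℂ)))) ((⨅ n : ℕ, ((MeasureTheory.volume {θ : Fin (n + 1) → ℝ | (∀ k, θ k ∈ Set.Ico (0:ℝ) (2 * Real.pi)) ∧ ∀ i j : ℕ, i + 2 ≤ j → j ≤ n + 1 → 1 < ‖(List.range i).foldl (fun (z : ℂ) (m : ℕ) => z + Complex.exp (↑(if h : m < n + 1 then θ ⟨m, h⟩ else 0) * Complex.I)) 0 - (List.range j).foldl (fun (z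 : ℂ) (m : ℕ) => z + Complex.exp (↑(if h : m < n + 1 then θ ⟨m, h⟩ else 0) * Complex.I)) 0‖}).toReal / (2 * Real.pi) ^ (n + 1)) ^ (1 / ((n : ℝ) + 1)))⁻¹) t (1 - r) (fun θ k => (List.range k).foldl (fun (z : ℂ) (j : ℕ) => (z + ↑t * Complex.exp (↑(θ j) * Complex.I)) / (1 + (starRingEnd ℂ) z * (↑t * Complex.exp (↑(θ j) * Complex.I)))) (↑(1 - r) : ℂ)))) id (Q t Literature.Probability.RandomPlanarGeometry.DobrushinDomain.unitDisc)) → ∀ D : Literature.Probability.RandomPlanarGeometry.DobrushinDomain, ∃ ν : MeasureTheory.Measure (Literature.Probability.RandomPlanarGeometry.CurveClass ℂ), MeasureTheory.IsProbabilityMeasure ν ∧ Literature.Probability.RandomPlanarGeometry.TendstoLaw (fun (_ : ℝ) (x : Literature.Probability.RandomPlanarGeometry.CurveClass ℂ) => x) (fun t => Q t D) id ν := by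
  sorry

/-- **Stub 3 (`limitsJoin`, lattice ↔ chain universality of subsequential limits; OPEN, hardest).**
[cite: LawlerSchrammWerner2004SAW, §3.4.2] [cite: MadrasSlade1993, §1.1] -/
theorem stub_limitsJoin : ∀ Q : ℝ → Literature.Probability.RandomPlanarGeometry.ChordalFamily, (∀ᶠ t in nhdsWithin (0:ℝ) (Set.Ioi 0), (Q t).IsChordal ∧ (Q t).IsConformallyCovariant ∧ Literature.Probability.RandomPlanarGeometry.TendstoLaw (fun (_ : ℝ) (x : Literature.Probability.RandomPlanarGeometry.CurveClass ℂ) => x) (fun r => (fun S : MeasureTheory.Measure (Literature.Probability.RandomPlanarGeometry.CurveClass ℂ) => (S Set.univ)⁻¹ • S) ((fun (xc t ρ : ℝ) (pos : (ℕ → ℝ) → ℕ → ℂ) => MeasureTheory.Measure.sum fun n : ℕ => ENNReal.ofReal ((xc / (2 * Real.pi)) ^ n) • ((MeasureTheory.volume.restrict {θ : Fin n → ℝ | (∀ k, θ k ∈ Set.Ico (0:ℝ) (2 * Real.pi)) ∧ (∀ i j : ℕ, i + 2 ≤ j → j ≤ n → t * ‖1 - (starRingEnd ℂ) (pos (fun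 k => if h : k < n then θ ⟨k, h⟩ else 0) i) * pos (fun k => if h : k < n then θ ⟨k, h⟩ else 0) j‖ < ‖pos (fun k => if h : k < n then θ ⟨k, h⟩ else 0) i - pos (fun k => if h : k < n then θ ⟨k, h⟩ else 0) j‖) ∧ 2 * ‖pos (fun k => if h : k < n then θ ⟨k, h⟩ else 0) n + ↑ρ‖ ≤ ‖1 + ↑ρ * pos (fun k => if h : k < n then θ ⟨k, h⟩ else 0) n‖}).map (fun θ => Literature.Probability.RandomPlanarGeometry.CurveClass.mk (⟨Literature.Probability.LatticeModels.polyline ((List.range (n + 1)).map (pos (fun k => if h : k < n then θ ⟨k, h⟩ else 0)))⟩ : Literature.Probability.RandomPlanarGeometry.Curve ℂ)))) ((⨅ n : ℕ, ((MeasureTheory.volume {θ : Fin (n + 1) → ℝ | (∀ k, θ k ∈ Set.Ico (0:ℝ) (2 * Real.pi)) ∧ ∀ i j : ℕ, i + 2 ≤ j → j ≤ n + 1 → 1 < ‖(List.range i).foldl (fun (z : ℂ) (m : ℕ) => z + Complex.exp (↑(if h : m < n + 1 then θ ⟨m, h⟩ else 0) * Complex.I)) 0 - (List.range j).foldl (fun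 (z : ℂ) (m : ℕ) => z + Complex.exp (↑(if h : m < n + 1 then θ ⟨m, h⟩ else 0) * Complex.I)) 0‖}).toReal / (2 * Real.pi) ^ (n + 1)) ^ (1 / ((n : ℝ) + 1)))⁻¹) t (1 - r) (fun θ k => (List.range k).foldl (fun (z : ℂ) (j : ℕ) => (z + ↑t * Complex.exp (↑(θ j) * Complex.I)) / (1 + (starRingEnd ℂ) z * (↑t * Complex.exp (↑(θ j) * Complex.I)))) (↑(1 - r) : ℂ)))) id (Q t Literature.Probability.RandomPlanarGeometry.DobrushinDomain.unitDisc)) → ∀ (D : Literature.Probability.RandomPlanarGeometry.DobrushinDomain) (a b : ℝ → Literature.Probability.LatticeModels.Site 2), Literature.Probability.RandomPlanarGeometry.SAW.IsEndpointApprox D a b → ∀ ν : MeasureTheory.Measure (Literature.Probability.RandomPlanarGeometry.CurveClass ℂ), MeasureTheory.IsProbabilityMeasure ν → Literature.Probability.RandomPlanarGeometry.TendstoLaw (fun (_ : ℝ) (x : Literature.Probability.RandomPlanarGeometry.CurveClass ℂ) => x) (fun t => Q t D) id ν → ∀ μ : MeasureTheory.Measure (Literature.Probability.RandomPlanarGeometry.CurveClass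 ℂ), MeasureTheory.IsProbabilityMeasure μ → Literature.Probability.RandomPlanarGeometry.IsSubseqLimitLaw (fun δ (γ : Literature.Probability.RandomPlanarGeometry.SAW.DomainSAW D.carrier δ (a δ) (b δ)) => γ.curve) (fun δ => Literature.Probability.RandomPlanarGeometry.SAW.law D.carrier δ (a δ) (b δ)) μ → μ = ν := by
  sorry

/-! Consistency: each registered theorem statement IS the corresponding `Stubs` `Prop` (definitional). -/

example : Stubs.stub_latticeTight := stub_latticeTight
example : Stubs.stub_chainLimit := stub_chainLimit
example : Stubs.stub_limitsJoin := stub_limitsJoin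

/-! ## The composition: the three stubs imply the crux (kernel-checked, no `sorry`) -/

/-- **`LatticeJoinsChain` from the three stubs.** Fix `Q` with the ChainLaw property, `(D; a, b)` and
an endpoint approximation. `stub_chainLimit` gives a probability law `ν` with `Q t D ⇒ ν` as
`t → 0⁺`. The critical SAW laws are probability measures for all small `δ`
(`eventually_isProbabilityMeasure_law`), the curve observable is measurable (`SAW.aemeasurable_curve`),
the family is tight (`stub_latticeTight`) and every probability subsequential limit is `ν`
(`stub_limitsJoin`, with `Tendsto s atTop (𝓝[>] 0)` assembled from positivity and `s → 0`), so
`tendstoLaw_of_isTightAlongMesh_of_eventually` (Prokhorov + subsequence principle) gives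
`SAW.law ⇒ ν`; the schedule `e = id` then makes the two integrals converge to the same value.
[cite: BillingsleyCPM1999, Thm. 5.1, Corollary] -/
theorem LatticeJoinsChain_of :
    Stubs.stub_latticeTight → Stubs.stub_chainLimit → Stubs.stub_limitsJoin → LatticeJoinsChain := by
  intro hT hC hJ Q hQ D a b hab
  obtain ⟨ν, hν, hlim⟩ := hC Q hQ D
  refine ⟨id, tendsto_id, fun f => ?_⟩
  have hSAW : TendstoLaw (fun δ (γ : SAW.DomainSAW D.carrier δ (a δ) (b δ)) => γ.curve)
      (fun δ => SAW.law D.carrier δ (a δ) (b δ)) id ν := by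
    refine tendstoLaw_of_isTightAlongMesh_of_eventually
      (SubseqIdentification.Negative.eventually_isProbabilityMeasure_law hab)
      (Eventually.of_forall fun δ => SAW.aemeasurable_curve D.carrier δ (a δ) (b δ))
      (hT D a b hab) ?_
    intro P' hP' s hpos hs hlimP'
    exact hJ Q hQ D a b hab ν hν hlim P' hP'
      ⟨s, tendsto_nhdsWithin_iff.2 ⟨hs, Eventually.of_forall fun n => Set.mem_Ioi.2 (hpos n)⟩, hlimP'⟩
  have h := (hSAW f).sub (hlim f)
  rw [sub_self] at h
  simpa using h

end Summit.CriticalPhenomena.SAWScalingLimit.Cruxes.LatticeJoinsChain.Birth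

end
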